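import Mathlib
import HarnessLib
import Summits.AtomisticToContinuum.HydrodynamicLimit.Theses.BallisticLaceBootstrap
import Literature.MathematicalPhysics.KineticTheory.HardSphereEulerProofs
import Literature.Analysis.FluidPDE.BoltzmannGradLimitProofs

/-!
# Crux `MarginalsToL2` (stmt-AtomisticToContinuum-12108, route BallisticLaceBootstrap, rank 9) — birth skeleton `Lines/birth.lean`

BC3 skeleton (registrar seat planner-skel-stmt-AtomisticToContinuum-12108-0, 2026-08-17). The crux
`Summit.AtomisticToContinuum.HydrodynamicLimit.Theses.BallisticLaceBootstrap.MarginalsToL2` is the route's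
VARIANCE STEP (a hypothesis of `closes`; folklore, Sznitman1991 Prop. 2.2 with unbounded tests): for the
transported local Gibbs density `W_N := 1_{D_ε} · (canonicalDensity(localGibbsProfile a₀ u₀ θ₀) ∘ Φ^N_{−t})`,
a.e. relabelling symmetry of `W_N`, `(1+|v|²)²`-weighted `L¹` convergence of its 1-marginal to
`g = ρ_t M_{1,θ_t,u_t}` and `(1+|v|²)(1+|v′|²)`-weighted factorisation of its 2-marginal imply the three
MEAN-SQUARE convergences of the empirical density / momentum / energy fields of `Φ^N_t z` under
`localGibbsLaw σ a₀ u₀ θ₀ N (Φ N)`. Its recorded risk (route file, `why it might fail`) is purely TYPING: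
(a) the law of `Φ^N_t z` under `localGibbsLaw` must have Lebesgue density exactly `W_N`, and (b) the
normalisation of `W_N` / `nthMarginal` must match the `(N+1)⁻¹` empirical average. The skeleton cuts the crux
along exactly that seam — TYPING (two stubs over the hard-sphere objects) vs MATHEMATICS (one stub with no
dynamics in it at all):

* `stub_lawOfFlow` (TYPING (a), size S–M): the push-forward of `localGibbsLaw σ a₀ u₀ θ₀ N (Φ N)` under the
  time-`t` map `(Φ N).flow t` is `volume.withDensity (ofReal ∘ W_N)` — mild Liouville equation for the canonical
  density. In tree: `localGibbsLaw = particleLaw Φ cd` (`localGibbsLaw_eq`), `map_flow_particleLaw` (density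
  `1_{good} · cd ∘ Φ_{−t}` for MEASURABLE `cd`, `measurable_canonicalDensity` + `measurable_localGibbsProfile`),
  and `1_{good} = 1_{D}` volume-a.e. (`good ⊆ D`, `liouville (goodᶜ) = 0`, `liouville = volume.restrict D`), so the
  two densities agree a.e. (`withDensity_congr_ae`).
* `stub_transportedDensityMass` (TYPING (b), size S–M): for every `N`, `W_N ≥ 0`, `W_N` is measurable, and EITHER
  `∫ W_N = 1` OR `W_N = 0` identically (the canonical partition function `Z_N ≥ 0`; if `Z_N = 0` then
  `canonicalDensity = 0` by the `0⁻¹ = 0` junk convention, else `∫ cd = 1` and the transported mass is `1` by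
  Liouville invariance `HardSphereFlow.measurePreserving` + `cd = 0` off `D`). The degenerate branch is REAL
  (the crux quantifies over every `σ > 0`; at large `σ` the spheres do not fit and `D = ∅` for large `N`).
* `stub_varianceFromMarginals` (THE MATHEMATICS, size M, hardest): the dynamics-free Sznitman variance step on
  `((𝕋³ × ℝ³)^{N+1}, W_N dz)` for an ARBITRARY family of nonnegative measurable sub-probability densities `W_N`
  of mass `0` or `1`, a.e. symmetric under relabelling: weighted-`L¹` convergence of `nthMarginal 1` to
  `g = n · M_{1,ϑ,w}` and weighted factorisation of `nthMarginal 2` imply, for every continuous `χ`,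
  `E_{W_N}|A_N(φ) − ∫φ g|² → 0` for the three observables `φ = χ(x), χ(x)v, χ(x)|v|²/2` (targets `∫χ n`,
  `∫(χ n) • w`, `∫χ E(n,w,ϑ)` by the Maxwellian moments `integral_localMaxwellian{_one,_smul,…}`): expand
  `E|A_N − c|² = (N+1)⁻¹∫φ² f¹ + N(N+1)⁻¹∫φ⊗φ f² − 2c∫φ f¹ + c²·m_N` by a.e. symmetry and Tonelli (`W_N ≥ 0`,
  so the Bochner `nthMarginal` is the true marginal a.e.), pass to the limit with the weights dominating
  `φ², φ ⊗ φ` (this is why the 1-marginal weight is `(1+|v|²)²`: the energy observable squared is quartic in `v`);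
  the mass-`0` branch forces `g = 0` a.e., hence `n = 0` a.e. (`M > 0` as `ϑ > 0`) and all targets vanish.
* `MarginalsToL2_of` (the glue, PROVED here, no `sorry`; hypotheses = the three stubs BY NAME through the
  `__Registered.stub_…` aliases of §1b): instantiate the variance step at `n, w, ϑ := ρ_t, u_t, θ_t` and the crux's
  own `W_N` (its `let`), feed it the density facts of stub 2, and pull the three limits back from the law
  `W_N dz` to `localGibbsLaw` along `(Φ N).flow t` with stub 1 and `lintegral_map` (measurability of the three
  integrands from `empirical{Density,Momentum,Energy}Field_eq_sum`). `MarginalsToL2_proof : MarginalsToL2` (no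
  hypotheses) is the crux modulo exactly the three sorried stubs.

Layout: §0 measurability helpers (sorry-free) · §1 statements as named `Prop`s · §1b `__Registered` aliases · §2 the
sorried stubs (signatures verbatim, `sorry` ONLY there) + definitional-agreement `example`s · §3 composition (sorry-free).

Disproof used: none — the crux has no `Disproof.lean` / `Negative/` lemmas on file (`ledger crux ls
stmt-AtomisticToContinuum-12108`: no workfiles, 2026-08-17). Negatives index: the OLD signature of the twin item
stmt-0806 was refuted (Refute0806.lean, refuter g35-0, 2026-08-13: junk `σ = −1` free flight + signed activity) and
RE-SIGNED; the present signature carries all the repairs (`0 < σ`, positive continuous profiles, the domain indicator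
in `W_N`, a.e. symmetry as a hypothesis) and was re-derived on paper by refuters g36-0 / g37-0 / g45-27. No stub is an
instance of the refuted statement: stubs 1–2 assume `0 < σ`, `a₀, θ₀ > 0`; stub 3 never mentions flows.
Leans on (by name): `Literature.MathematicalPhysics.KineticTheory.{localGibbsLaw, localGibbsLaw_eq, localGibbsMeasure,
measurable_canonicalDensity, measurable_localGibbsProfile, canonicalDensity_eq_zero_of_notMem, hsDiameter, T3, V3,
empiricalDensityField_eq_sum, empiricalMomentumField_eq_sum, empiricalEnergyField_eq_sum, integral_localMaxwellian,
integral_localMaxwellian_one, integral_localMaxwellian_smul}`, `Literature.Analysis.FluidPDE.{HardSphereFlow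
(+ .measurable_flow, .measurePreserving, .good, .measure_compl_good), particleLaw, map_flow_particleLaw,
integral_map_flow_particleLaw, hsTransport, canonicalDensity, canonicalPartition, nthMarginal, marginal, hardSphereDomain,
liouville_eq, localMaxwellian, exists_permEquiv}`, Mathlib `MeasureTheory.lintegral_map`, `MeasureTheory.withDensity_congr_ae`,
`MeasureTheory.meas_ge_le_lintegral_div` (not needed here: Chebyshev lives in `closes`).
-/

namespace Summit.AtomisticToContinuum.HydrodynamicLimit.Cruxes.MarginalsToL2.Birth

open scoped BigOperators Topology Classical MeasureTheory ProbabilityTheory InnerProductSpace ENNReal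
open Filter Set Function MeasureTheory
open Literature.Analysis.FluidPDE Literature.MathematicalPhysics.KineticTheory

/-! ## §0 Measurability of the three empirical fields (finite averages of continuous functions; sorry-free helpers) -/

/-- Positions of the particles are measurable coordinates of the configuration. -/
theorem measurable_pos (N : ℕ) (i : Fin N) : Measurable fun z : Config N (Fin 3) T3 => (z i).1 :=
  (measurable_pi_apply i).fst

/-- Velocities of the particles are measurable coordinates of the configuration. -/
theorem measurable_vel (N : ℕ) (i : Fin N) : Measurable fun z : Config N (Fin 3) T3 => (z i).2 :=
  (measurable_pi_apply i).snd

/-- The empirical density field tested against a continuous `χ` is a measurable function of the configuration. -/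
theorem measurable_empiricalDensityField (N : ℕ) {χ : T3 → ℝ} (hχ : Continuous χ) :
    Measurable fun z : Config N (Fin 3) T3 => empiricalDensityField z χ := by
  simp_rw [empiricalDensityField_eq_sum]
  exact measurable_const.mul
    (Finset.measurable_sum _ fun i _ => hχ.measurable.comp (measurable_pos N i))

/-- The empirical momentum field tested against a continuous `χ` is a measurable function of the configuration. -/
theorem measurable_empiricalMomentumField (N : ℕ) {χ : T3 → ℝ} (hχ : Continuous χ) :
    Measurable fun z : Config N (Fin 3) T3 => empiricalMomentumField z χ := by
  simp_rw [empiricalMomentumField_eq_sum]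
  exact (Finset.measurable_sum _ fun i _ =>
    (hχ.measurable.comp (measurable_pos N i)).smul (measurable_vel N i)).const_smul ((N : ℝ)⁻¹)

/-- The empirical energy field tested against a continuous `χ` is a measurable function of the configuration. -/
theorem measurable_empiricalEnergyField (N : ℕ) {χ : T3 → ℝ} (hχ : Continuous χ) :
    Measurable fun z : Config N (Fin 3) T3 => empiricalEnergyField z χ := by
  simp_rw [empiricalEnergyField_eq_sum]
  exact measurable_const.mul (Finset.measurable_sum _ fun i _ =>
    (hχ.measurable.comp (measurable_pos N i)).mul
      (((measurable_vel N i).norm.pow_const 2).div_const 2))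

/-! ## §1 The three stub STATEMENTS as named `Prop`s (verbatim the signatures of the sorried stubs of §2) -/

/-- Statement of stub 1 — LAW OF THE TIME-`t` CONFIGURATION (typing risk (a) of the crux): for `σ > 0`, positive
continuous profiles, every family of hard-sphere flows `Φ`, every `t` and `N`, the push-forward of the local Gibbs law
under `(Φ N).flow t` is Lebesgue measure with density `W_N = 1_{D_ε} · (canonicalDensity(localGibbsProfile) ∘ Φ^N_{−t})`
— VERBATIM the crux's `let W`. Why plausible: `map_flow_particleLaw` gives the density `1_{good} · cd ∘ Φ_{−t}` and
`good` is a volume-conull subset of `D_ε`. Size S–M. [GST2013 §4.2, Prop. 4.1.1; Alexander1975] -/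
def LawOfFlow : Prop :=
  ∀ (σ : ℝ) (a₀ θ₀ : T3 → ℝ) (u₀ : T3 → V3)
    (Φ : (N : ℕ) → HardSphereFlow (Torus.geometry (Fin 3)) (hsDiameter σ N) (N + 1)) (t : ℝ),
    0 < σ → Continuous a₀ → Continuous θ₀ → Continuous u₀ → (∀ x, 0 < a₀ x) → (∀ x, 0 < θ₀ x) →
    ∀ N : ℕ,
      (localGibbsLaw σ a₀ u₀ θ₀ N (Φ N)).map ((Φ N).flow t) =
        volume.withDensity (fun z : Config (N + 1) (Fin 3) T3 => ENNReal.ofReal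
          ((hardSphereDomain (Torus.geometry (Fin 3)) (N + 1) (hsDiameter σ N)).indicator
            (hsTransport (Φ N) t (canonicalDensity (Torus.geometry (Fin 3)) (hsDiameter σ N) (N + 1)
              (localGibbsProfile a₀ u₀ θ₀))) z))

/-- Statement of stub 2 — NONNEGATIVITY, MEASURABILITY AND MASS DICHOTOMY OF THE TRANSPORTED DENSITY (typing risk (b)):
for every `N`, the crux's `W_N` is pointwise `≥ 0`, measurable, and either integrates to `1` (canonical partition
function `Z_N > 0`: `∫ cd = 1`, Liouville invariance of `Φ^N_{−t}`, `cd = 0` off `D_ε`) or vanishes identically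
(`Z_N = 0`, the `0⁻¹ = 0` branch of `canonicalDensity` — it happens for large `σ`). Size S–M.
[GST2013 (6.1.2)–(6.1.3), Prop. 4.1.1; Spohn1991 Part I §2.3] -/
def TransportedDensityMass : Prop :=
  ∀ (σ : ℝ) (a₀ θ₀ : T3 → ℝ) (u₀ : T3 → V3)
    (Φ : (N : ℕ) → HardSphereFlow (Torus.geometry (Fin 3)) (hsDiameter σ N) (N + 1)) (t : ℝ),
    0 < σ → Continuous a₀ → Continuous θ₀ → Continuous u₀ → (∀ x, 0 < a₀ x) → (∀ x, 0 < θ₀ x) →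
    ∀ N : ℕ,
      let W : Config (N + 1) (Fin 3) T3 → ℝ :=
        (hardSphereDomain (Torus.geometry (Fin 3)) (N + 1) (hsDiameter σ N)).indicator
          (hsTransport (Φ N) t (canonicalDensity (Torus.geometry (Fin 3)) (hsDiameter σ N) (N + 1)
            (localGibbsProfile a₀ u₀ θ₀)))
      (∀ z, 0 ≤ W z) ∧ Measurable W ∧ (∫ z, W z = 1 ∨ W = 0)

/-- Statement of stub 3 — THE VARIANCE STEP FROM MARGINALS (Sznitman1991 Prop. 2.2 (i)⇒(ii) with unbounded tests; the
mathematics of the crux, with NO dynamics): on `(𝕋³ × ℝ³)^{N+1}` let `W_N ≥ 0` be measurable of mass `1` or `0`, a.e.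
symmetric under relabelling; if `nthMarginal 1 (W_N) → g := n · M_{1,ϑ,w}` in `(1+|v|²)²`-weighted `L¹` and
`nthMarginal 2 (W_N) − nthMarginal 1 ⊗ nthMarginal 1 → 0` in `(1+|v|²)(1+|v′|²)`-weighted `L¹`, then for every
continuous `χ` the mean squares under `W_N dz` of `A_N(χ) − ∫χ n`, `A_N(χ v) − ∫(χ n) • w`, `A_N(χ|v|²/2) − ∫χ E(n,w,ϑ)`
tend to `0` (`n, w, ϑ` continuous, `ϑ > 0`). Why it might fail: only through the Bochner/`nthMarginal` junk conventions
in the mass-`0` branch (handled: `g = 0` a.e. is forced). Size M (300–450 lines: variance identity by symmetry + Tonelli,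
Maxwellian moments, weighted domination). [Sznitman1991 Prop. 2.2; GST2013 §2.4; Spohn1991 Part I §2.3] -/
def VarianceFromMarginals : Prop :=
  ∀ (n ϑ : T3 → ℝ) (w : T3 → V3) (W : (N : ℕ) → Config (N + 1) (Fin 3) T3 → ℝ),
    Continuous n → Continuous w → Continuous ϑ → (∀ x, 0 < ϑ x) →
    (∀ N z, 0 ≤ W N z) → (∀ N, Measurable (W N)) → (∀ N, ∫ z, W N z = 1 ∨ W N = 0) →
    let g : T3 × V3 → ℝ := fun y => n y.1 * localMaxwellian 1 (ϑ y.1) (w y.1) y.2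
    (∀ (N : ℕ) (π : Equiv.Perm (Fin (N + 1))),
      Filter.EventuallyEq (MeasureTheory.ae MeasureTheory.volume) (fun z => W N (z ∘ π)) (W N)) →
    Filter.Tendsto (fun N : ℕ => ∫⁻ y : T3 × V3,
      ENNReal.ofReal ((1 + ‖y.2‖ ^ 2) ^ 2 * |nthMarginal (N + 1) 1 (W N) (fun _ => y) - g y|))
      Filter.atTop (nhds 0) →
    Filter.Tendsto (fun N : ℕ => ∫⁻ p : (T3 × V3) × (T3 × V3),
      ENNReal.ofReal ((1 + ‖p.1.2‖ ^ 2) * (1 + ‖p.2.2‖ ^ 2) *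
        |nthMarginal (N + 1) 2 (W N) ![p.1, p.2] -
          nthMarginal (N + 1) 1 (W N) ![p.1] * nthMarginal (N + 1) 1 (W N) ![p.2]|))
      Filter.atTop (nhds 0) →
    ∀ χ : T3 → ℝ, Continuous χ →
      Filter.Tendsto (fun N : ℕ => ∫⁻ z, ENNReal.ofReal
          (|empiricalDensityField z χ - ∫ x, χ x * n x| ^ 2)
          ∂(volume.withDensity fun z => ENNReal.ofReal (W N z))) Filter.atTop (nhds 0) ∧
      Filter.Tendsto (fun N : ℕ => ∫⁻ z, ENNReal.ofReal
          (‖empiricalMomentumField z χ - ∫ x, (χ x * n x) • w x‖ ^ 2)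
          ∂(volume.withDensity fun z => ENNReal.ofReal (W N z))) Filter.atTop (nhds 0) ∧
      Filter.Tendsto (fun N : ℕ => ∫⁻ z, ENNReal.ofReal
          (|empiricalEnergyField z χ - ∫ x, χ x * totalEnergyDensity (n x) (w x) (ϑ x)| ^ 2)
          ∂(volume.withDensity fun z => ENNReal.ofReal (W N z))) Filter.atTop (nhds 0)

/-! ## §1b The statements BY STUB NAME — admissible hypotheses of `MarginalsToL2_of`

`#h21_check_skeleton` (run by `ledger skeleton check`) admits a hypothesis of the composing theorem only if its head
constant is a registered obligation or is NAMED like a declared stub (last name component), and `@[stub]` is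
gate-reserved; so each statement is mirrored by `abbrev __Registered.stub_X : Prop := X` (device of the sibling birth
skeletons `UpperVolumeLemma/Lines/birth.lean`, `ChaosClosure/Lines/birth.lean`). -/
namespace __Registered

/-- Alias of `LawOfFlow`, keyed by the registered name `stub_lawOfFlow`. -/
abbrev stub_lawOfFlow : Prop := LawOfFlow

/-- Alias of `TransportedDensityMass`, keyed by the registered name `stub_transportedDensityMass`. -/
abbrev stub_transportedDensityMass : Prop := TransportedDensityMass

/-- Alias of `VarianceFromMarginals`, keyed by the registered name `stub_varianceFromMarginals`. -/
abbrev stub_varianceFromMarginals : Prop := VarianceFromMarginals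

end __Registered

/-! ## §2 The registered stubs (the open obligations; `sorry` lives ONLY here; signatures = the statements verbatim) -/

/-- STUB 1 (law of the time-`t` configuration; size S–M): body VERBATIM `LawOfFlow`. -/
theorem stub_lawOfFlow :
  ∀ (σ : ℝ) (a₀ θ₀ : T3 → ℝ) (u₀ : T3 → V3)
    (Φ : (N : ℕ) → HardSphereFlow (Torus.geometry (Fin 3)) (hsDiameter σ N) (N + 1)) (t : ℝ),
    0 < σ → Continuous a₀ → Continuous θ₀ → Continuous u₀ → (∀ x, 0 < a₀ x) → (∀ x, 0 < θ₀ x) →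
    ∀ N : ℕ,
      (localGibbsLaw σ a₀ u₀ θ₀ N (Φ N)).map ((Φ N).flow t) =
        volume.withDensity (fun z : Config (N + 1) (Fin 3) T3 => ENNReal.ofReal
          ((hardSphereDomain (Torus.geometry (Fin 3)) (N + 1) (hsDiameter σ N)).indicator
            (hsTransport (Φ N) t (canonicalDensity (Torus.geometry (Fin 3)) (hsDiameter σ N) (N + 1)
              (localGibbsProfile a₀ u₀ θ₀))) z)) := by
  sorry

/-- STUB 2 (nonnegativity, measurability, mass `1` or `0` of the transported density; size S–M): body VERBATIM
`TransportedDensityMass`. -/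
theorem stub_transportedDensityMass :
  ∀ (σ : ℝ) (a₀ θ₀ : T3 → ℝ) (u₀ : T3 → V3)
    (Φ : (N : ℕ) → HardSphereFlow (Torus.geometry (Fin 3)) (hsDiameter σ N) (N + 1)) (t : ℝ),
    0 < σ → Continuous a₀ → Continuous θ₀ → Continuous u₀ → (∀ x, 0 < a₀ x) → (∀ x, 0 < θ₀ x) →
    ∀ N : ℕ,
      let W : Config (N + 1) (Fin 3) T3 → ℝ :=
        (hardSphereDomain (Torus.geometry (Fin 3)) (N + 1) (hsDiameter σ N)).indicator
          (hsTransport (Φ N) t (canonicalDensity (Torus.geometry (Fin 3)) (hsDiameter σ N) (N + 1)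
            (localGibbsProfile a₀ u₀ θ₀)))
      (∀ z, 0 ≤ W z) ∧ Measurable W ∧ (∫ z, W z = 1 ∨ W = 0) := by
  sorry

/-- STUB 3 (the variance step from marginals, Sznitman1991 Prop. 2.2; size M, THE HARDEST): body VERBATIM
`VarianceFromMarginals`. -/
theorem stub_varianceFromMarginals :
  ∀ (n ϑ : T3 → ℝ) (w : T3 → V3) (W : (N : ℕ) → Config (N + 1) (Fin 3) T3 → ℝ),
    Continuous n → Continuous w → Continuous ϑ → (∀ x, 0 < ϑ x) →
    (∀ N z, 0 ≤ W N z) → (∀ N, Measurable (W N)) → (∀ N, ∫ z, W N z = 1 ∨ W N = 0) →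
    let g : T3 × V3 → ℝ := fun y => n y.1 * localMaxwellian 1 (ϑ y.1) (w y.1) y.2
    (∀ (N : ℕ) (π : Equiv.Perm (Fin (N + 1))),
      Filter.EventuallyEq (MeasureTheory.ae MeasureTheory.volume) (fun z => W N (z ∘ π)) (W N)) →
    Filter.Tendsto (fun N : ℕ => ∫⁻ y : T3 × V3,
      ENNReal.ofReal ((1 + ‖y.2‖ ^ 2) ^ 2 * |nthMarginal (N + 1) 1 (W N) (fun _ => y) - g y|))
      Filter.atTop (nhds 0) →
    Filter.Tendsto (fun N : ℕ => ∫⁻ p : (T3 × V3) × (T3 × V3),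
      ENNReal.ofReal ((1 + ‖p.1.2‖ ^ 2) * (1 + ‖p.2.2‖ ^ 2) *
        |nthMarginal (N + 1) 2 (W N) ![p.1, p.2] -
          nthMarginal (N + 1) 1 (W N) ![p.1] * nthMarginal (N + 1) 1 (W N) ![p.2]|))
      Filter.atTop (nhds 0) →
    ∀ χ : T3 → ℝ, Continuous χ →
      Filter.Tendsto (fun N : ℕ => ∫⁻ z, ENNReal.ofReal
          (|empiricalDensityField z χ - ∫ x, χ x * n x| ^ 2)
          ∂(volume.withDensity fun z => ENNReal.ofReal (W N z))) Filter.atTop (nhds 0) ∧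
      Filter.Tendsto (fun N : ℕ => ∫⁻ z, ENNReal.ofReal
          (‖empiricalMomentumField z χ - ∫ x, (χ x * n x) • w x‖ ^ 2)
          ∂(volume.withDensity fun z => ENNReal.ofReal (W N z))) Filter.atTop (nhds 0) ∧
      Filter.Tendsto (fun N : ℕ => ∫⁻ z, ENNReal.ofReal
          (|empiricalEnergyField z χ - ∫ x, χ x * totalEnergyDensity (n x) (w x) (ϑ x)| ^ 2)
          ∂(volume.withDensity fun z => ENNReal.ofReal (W N z))) Filter.atTop (nhds 0) := by
  sorry

/-- The registered theorems, the `__Registered` aliases and the named `Prop`s are the same statements. -/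
example : __Registered.stub_lawOfFlow := stub_lawOfFlow
example : __Registered.stub_transportedDensityMass := stub_transportedDensityMass
example : __Registered.stub_varianceFromMarginals := stub_varianceFromMarginals
example : LawOfFlow = __Registered.stub_lawOfFlow := rfl
example : TransportedDensityMass = __Registered.stub_transportedDensityMass := rfl
example : VarianceFromMarginals = __Registered.stub_varianceFromMarginals := rfl

/-! ## §3 Composition (kernel-checked; no `sorry` below this line) -/

/-- **THE GLUE / SKELETON THEOREM** `stub₁ → stub₂ → stub₃ → MarginalsToL2` (the crux BY NAME; hypotheses = the three
registered stubs by name via their `__Registered` aliases; no `sorry`): instantiate the variance step (stub 3) at the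
time-`t` slices `ρ_t, u_t, θ_t` and at the crux's own transported density `W` (its `let`), feeding it the pointwise
nonnegativity / measurability / mass dichotomy of stub 2; then pull each of the three mean-square limits back from the
law `W_N dz` to `localGibbsLaw σ a₀ u₀ θ₀ N (Φ N)` along `(Φ N).flow t` by the law identity of stub 1 and
`lintegral_map` (the integrands are measurable: finite averages of continuous functions, §0). -/
theorem MarginalsToL2_of :
    __Registered.stub_lawOfFlow → __Registered.stub_transportedDensityMass →
      __Registered.stub_varianceFromMarginals →
      Summit.AtomisticToContinuum.HydrodynamicLimit.Theses.BallisticLaceBootstrap.MarginalsToL2 := by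
  intro hlaw hden hvar σ a₀ θ₀ u₀ ρ θ u Φ t hσ ha hθ hu ha0 hθ0 hρc huc hθc hθt W g hsym h1 h2 χ hχ
  -- stub 2: the density facts, read on the crux's own `W`
  have hW : ∀ N, (∀ z, 0 ≤ W N z) ∧ Measurable (W N) ∧ (∫ z, W N z = 1 ∨ W N = 0) :=
    fun N => hden σ a₀ θ₀ u₀ Φ t hσ ha hθ hu ha0 hθ0 N
  -- stub 3: the variance step on the laws `W N dz`
  have hV := hvar (ρ t) (θ t) (u t) W hρc huc hθc hθt (fun N => (hW N).1) (fun N => (hW N).2.1)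
    (fun N => (hW N).2.2) hsym h1 h2 χ hχ
  obtain ⟨hd, hm, he⟩ := hV
  -- stub 1: the law of `(Φ N).flow t z` under the local Gibbs law is `W N dz`
  have hL : ∀ N, (localGibbsLaw σ a₀ u₀ θ₀ N (Φ N)).map ((Φ N).flow t) =
      volume.withDensity (fun z => ENNReal.ofReal (W N z)) :=
    fun N => hlaw σ a₀ θ₀ u₀ Φ t hσ ha hθ hu ha0 hθ0 N
  -- transfer of a mean square along the flow (change of variables under the push-forward)
  have transfer : ∀ (F : (N : ℕ) → Config (N + 1) (Fin 3) T3 → ℝ≥0∞), (∀ N, Measurable (F N)) →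
      Filter.Tendsto (fun N : ℕ => ∫⁻ z, F N z ∂(volume.withDensity fun z => ENNReal.ofReal (W N z)))
        Filter.atTop (nhds 0) →
      Filter.Tendsto (fun N : ℕ => ∫⁻ z, F N ((Φ N).flow t z) ∂(localGibbsLaw σ a₀ u₀ θ₀ N (Φ N)))
        Filter.atTop (nhds 0) := by
    intro F hF hT
    refine hT.congr fun N => ?_
    rw [← hL N]
    exact lintegral_map (hF N) ((Φ N).measurable_flow t)
  refine ⟨?_, ?_, ?_⟩
  · exact transfer (fun N z => ENNReal.ofReal (|empiricalDensityField z χ - ∫ x, χ x * ρ t x| ^ 2))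
      (fun N => (((measurable_empiricalDensityField (N + 1) hχ).sub_const _).abs.pow_const 2).ennreal_ofReal)
      hd
  · exact transfer (fun N z => ENNReal.ofReal (‖empiricalMomentumField z χ - ∫ x, (χ x * ρ t x) • u t x‖ ^ 2))
      (fun N => (((measurable_empiricalMomentumField (N + 1) hχ).sub_const _).norm.pow_const 2).ennreal_ofReal)
      hm
  · exact transfer (fun N z => ENNReal.ofReal
        (|empiricalEnergyField z χ - ∫ x, χ x * totalEnergyDensity (ρ t x) (u t x) (θ t x)| ^ 2))
      (fun N => (((measurable_empiricalEnergyField (N + 1) hχ).sub_const _).abs.pow_const 2).ennreal_ofReal)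
      he

/-- **The line's closing theorem, modulo the three registered stubs** (the crux BY NAME with no hypotheses; it
depends on `sorryAx` exactly through `stub_lawOfFlow`, `stub_transportedDensityMass`, `stub_varianceFromMarginals`
and becomes the crux proof when they land). -/
theorem MarginalsToL2_proof :
    Summit.AtomisticToContinuum.HydrodynamicLimit.Theses.BallisticLaceBootstrap.MarginalsToL2 :=
  MarginalsToL2_of stub_lawOfFlow stub_transportedDensityMass stub_varianceFromMarginals

end Summit.AtomisticToContinuum.HydrodynamicLimit.Cruxes.MarginalsToL2.Birth
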